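import Mathlib
import HarnessLib
import Summits.HubbardSuperconductivity.HubbardSuperconductivity.Theorems.KLProgrammeC4aPPKernelPartition

/-!
# Route `KLProgramme` — crux C4a, S3 brick (B4) «(B4)-UMK1», «(M1)-FAMILY» part 18: THE SMOOTH SYMMETRIC-FLOOR PARTITION of the true pp kernel — objects for
# k3c3-p3's «(U1)-M-LAW» (pen (R384) item (a): the comparable-levels piece must be `C²` in the partner variable on all of ℝ)

Cell `gate-hubbard-kl`, seat hubbard-kl-k3c3-p1 (g16; row «δμ-flow with klAngularMean constant piece»).  The max-floor partition of part 11 (`ppMiddleKernel`) has a kink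
in `u` at `|u| = lo` (through `max |u| lo`), not admissible for the M-law ((q2) = YES, KL STATUS 06:34Z).  Cure of record (memo §11): the SMOOTH SYMMETRIC FLOOR
`m̃(x) = √(x² + lo²)` and the ONE ratio `r(e,u) = m̃(e)/(m̃(e) + m̃(u))`, with `r(u,e) = 1 − r(e,u)`:
* defs **`ppSmoothScale lo x := √(x²+lo²)`**, **`ppSmoothRatio lo e u`**, **`ppFarKernelS β Λ κ lo e u := P(e,u)·κ(r(e,u))`** (far piece), **`ppMidKernelS β Λ κ lo e u :=
  P(e,u)·(1 − κ(r(e,u)) − κ(1 − r(e,u)))`** (comparable-levels piece);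
* `ppSmoothScale_pos/_abs_le/_lo_le/_le_add`, `contDiff_ppSmoothScale` (C^∞), `ppSmoothRatio_mem_Ioo`, **`ppSmoothRatio_swap`** (`r(u,e) = 1 − r(e,u)`), `contDiff_ppSmoothRatio`
  (C^∞ in `u`);
* **`ppFarKernelS_swap`** (the mirror far piece `swap(A) = P·κ(1 − r)`), **`ppTrueKernel_eq_farS_add_swap_add_midS`** (`P = A + swap A + M`), **`ppMidKernelS_symm`**;
* support: **`ppFarKernelS_eq_zero_of_scale_le`** (`m̃(u) ≤ ((1−t₁)/t₁)·m̃(e) ⟹ A = 0`), **`ppFarKernelS_eq_zero_of_abs_le`** (`|u| ≤ qs·|e|`, `1 ≤ qs ≤ (1−t₁)/t₁ ⟹ A = 0` — the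
  law's two-sided support zone), **`ppMidKernelS_eq_zero_of_scale_le_right/left`** (comparability support both ways, profiles with `κ = 1` on `[0,t₁/2]`);
* envelopes: **`abs_ppFarKernelS_le`**, **`abs_ppMidKernelS_le`** (`≤ κ₀|P|`, `≤ (1+2κ₀)|P|`).
The thirteen law rows for `ppFarKernelS` and the M-law rows for `ppMidKernelS` (derivatives, flatness) are the successor's items (memo §11, HANDOFF § g16 FINAL).
Pure real analysis on Literature objects; nothing asserts (C), K3, the window or superconductivity.
References: BGM 2006 §2.4 (2.36) [cite: BenfattoGiulianiMastropietro2006]; FST II CPAM 51 (1998) §3 [cite: FeldmanSalmhoferTrubowitz1998].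
-/

noncomputable section

namespace Summit.HubbardSuperconductivity.HubbardSuperconductivity.Theorems.C4a

set_option linter.dupNamespace false -- summit = problem name (single-conjunct summit), D-0017

open Real Filter Set
open scoped Topology
open Literature.MathematicalPhysics.QuantumLattice Literature.Analysis.SpecialFunctions

/-! ## §1 The smooth floor and the symmetric ratio -/

/-- **Smooth floor** `m̃(x) = √(x² + lo²)`. -/
def ppSmoothScale (lo x : ℝ) : ℝ := Real.sqrt (x ^ 2 + lo ^ 2)

/-- **Symmetric split ratio** `r(e,u) = m̃(e)/(m̃(e) + m̃(u))`. -/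
def ppSmoothRatio (lo e u : ℝ) : ℝ := ppSmoothScale lo e / (ppSmoothScale lo e + ppSmoothScale lo u)

/-- `m̃(x) > 0` for `lo > 0`. [folklore] -/
theorem ppSmoothScale_pos {lo : ℝ} (hlo : 0 < lo) (x : ℝ) : 0 < ppSmoothScale lo x :=
  Real.sqrt_pos.2 (by positivity)

/-- `|x| ≤ m̃(x)`. [folklore] -/
theorem abs_le_ppSmoothScale (lo x : ℝ) : |x| ≤ ppSmoothScale lo x := by
  unfold ppSmoothScale
  rw [← Real.sqrt_sq_eq_abs]
  exact Real.sqrt_le_sqrt (by nlinarith [sq_nonneg lo])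

/-- `lo ≤ m̃(x)` for `lo ≥ 0`. [folklore] -/
theorem le_ppSmoothScale {lo : ℝ} (hlo : 0 ≤ lo) (x : ℝ) : lo ≤ ppSmoothScale lo x := by
  unfold ppSmoothScale
  calc lo = Real.sqrt (lo ^ 2) := (Real.sqrt_sq hlo).symm
    _ ≤ Real.sqrt (x ^ 2 + lo ^ 2) := Real.sqrt_le_sqrt (by nlinarith [sq_nonneg x])

/-- `m̃(x) ≤ |x| + lo` for `lo ≥ 0`. [folklore] -/
theorem ppSmoothScale_le_add {lo : ℝ} (hlo : 0 ≤ lo) (x : ℝ) : ppSmoothScale lo x ≤ |x| + lo := by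
  unfold ppSmoothScale
  rw [Real.sqrt_le_left (by positivity)]
  nlinarith [abs_nonneg x, sq_abs x]

/-- `m̃` is even: `m̃(−x) = m̃(x)`. [folklore] -/
theorem ppSmoothScale_neg (lo x : ℝ) : ppSmoothScale lo (-x) = ppSmoothScale lo x := by
  unfold ppSmoothScale; rw [neg_sq]

/-- Monotonicity in `|x|`: `|x| ≤ |y| ⟹ m̃(x) ≤ m̃(y)`. [folklore] -/
theorem ppSmoothScale_mono {lo x y : ℝ} (h : |x| ≤ |y|) : ppSmoothScale lo x ≤ ppSmoothScale lo y := by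
  unfold ppSmoothScale
  refine Real.sqrt_le_sqrt ?_
  nlinarith [sq_abs x, sq_abs y, abs_nonneg x]

/-- Scaling: `m̃(q·x)… ≤ q·m̃(x)` for `q ≥ 1`, in the form `|u| ≤ q|e| ⟹ m̃(u) ≤ q·m̃(e)`. [folklore] -/
theorem ppSmoothScale_le_mul {lo q e u : ℝ} (hq : 1 ≤ q) (hu : |u| ≤ q * |e|) : ppSmoothScale lo u ≤ q * ppSmoothScale lo e := by
  unfold ppSmoothScale
  have hq0 : 0 ≤ q := by linarith
  rw [show q * Real.sqrt (e ^ 2 + lo ^ 2) = Real.sqrt ((q * |e|) ^ 2 + (q * lo) ^ 2) by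
    rw [show (q * |e|) ^ 2 + (q * lo) ^ 2 = q ^ 2 * (e ^ 2 + lo ^ 2) by rw [mul_pow, mul_pow, sq_abs]; ring,
      Real.sqrt_mul' _ (by positivity), Real.sqrt_sq hq0]]
  refine Real.sqrt_le_sqrt ?_
  have h1 : u ^ 2 ≤ (q * |e|) ^ 2 := by rw [← sq_abs u]; exact pow_le_pow_left₀ (abs_nonneg u) hu 2
  have h2 : lo ^ 2 ≤ (q * lo) ^ 2 := by
    rw [mul_pow]; nlinarith [sq_nonneg lo, one_le_pow₀ (M₀ := ℝ) hq (n := 2)]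
  linarith

/-- `m̃` is `C^∞`. [folklore] -/
theorem contDiff_ppSmoothScale {lo : ℝ} (hlo : 0 < lo) {n : ℕ∞} : ContDiff ℝ n (ppSmoothScale lo) := by
  unfold ppSmoothScale
  exact ContDiff.sqrt (by fun_prop) fun x => by positivity

/-- `r(e,u) ∈ (0,1)`. [folklore] -/
theorem ppSmoothRatio_mem_Ioo {lo : ℝ} (hlo : 0 < lo) (e u : ℝ) : ppSmoothRatio lo e u ∈ Ioo (0 : ℝ) 1 := by
  have h1 := ppSmoothScale_pos hlo e
  have h2 := ppSmoothScale_pos hlo u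
  unfold ppSmoothRatio
  exact ⟨div_pos h1 (by linarith), (div_lt_one (by linarith)).2 (by linarith)⟩

/-- **Swap symmetry of the ratio**: `r(u,e) = 1 − r(e,u)`. [folklore] -/
theorem ppSmoothRatio_swap {lo : ℝ} (hlo : 0 < lo) (e u : ℝ) : ppSmoothRatio lo u e = 1 - ppSmoothRatio lo e u := by
  have h1 := ppSmoothScale_pos hlo e
  have h2 := ppSmoothScale_pos hlo u
  unfold ppSmoothRatio
  field_simp
  ring

/-- `r(e,·)` is `C^∞` in the partner variable. [folklore] -/
theorem contDiff_ppSmoothRatio {lo : ℝ} (hlo : 0 < lo) (e : ℝ) {n : ℕ∞} : ContDiff ℝ n (fun u => ppSmoothRatio lo e u) := by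
  unfold ppSmoothRatio
  refine contDiff_const.div (contDiff_const.add (contDiff_ppSmoothScale hlo)) fun u => ?_
  have h1 := ppSmoothScale_pos hlo e
  have h2 := ppSmoothScale_pos hlo u
  positivity

/-- `r` is jointly continuous. [folklore] -/
theorem continuous_ppSmoothRatio₂ {lo : ℝ} (hlo : 0 < lo) : Continuous fun p : ℝ × ℝ => ppSmoothRatio lo p.1 p.2 := by
  unfold ppSmoothRatio ppSmoothScale
  refine Continuous.div (by fun_prop) (by fun_prop) fun p => ?_
  have h1 := ppSmoothScale_pos hlo p.1
  have h2 := ppSmoothScale_pos hlo p.2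
  unfold ppSmoothScale at h1 h2
  positivity

/-! ## §2 The smooth far piece and the smooth comparable-levels piece -/

/-- **Smooth far piece** `A(e,u) = P(e,u)·κ(r(e,u))`: alive where the partner is the coarser line. -/
def ppFarKernelS (β Λ : ℝ) (κ : ℝ → ℝ) (lo e u : ℝ) : ℝ := ppTrueKernel β Λ e u * κ (ppSmoothRatio lo e u)

/-- **Smooth comparable-levels piece** `M(e,u) = P(e,u)·(1 − κ(r) − κ(1−r))`, `r = r(e,u)`. -/
def ppMidKernelS (β Λ : ℝ) (κ : ℝ → ℝ) (lo e u : ℝ) : ℝ :=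
  ppTrueKernel β Λ e u * (1 - κ (ppSmoothRatio lo e u) - κ (1 - ppSmoothRatio lo e u))

/-- **The mirror far piece is `P·κ(1 − r)`**: `ppFarKernelS … u e = P(e,u)·κ(1 − r(e,u))`. [folklore] -/
theorem ppFarKernelS_swap {β Λ : ℝ} (κ : ℝ → ℝ) {lo : ℝ} (hlo : 0 < lo) (e u : ℝ) :
    ppFarKernelS β Λ κ lo u e = ppTrueKernel β Λ e u * κ (1 - ppSmoothRatio lo e u) := by
  unfold ppFarKernelS
  rw [ppTrueKernel_symm, ppSmoothRatio_swap hlo]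

/-- **`P = A + swap A + M`** for the smooth pieces. [folklore] -/
theorem ppTrueKernel_eq_farS_add_swap_add_midS {β Λ : ℝ} (κ : ℝ → ℝ) {lo : ℝ} (hlo : 0 < lo) (e u : ℝ) :
    ppTrueKernel β Λ e u = ppFarKernelS β Λ κ lo e u + ppFarKernelS β Λ κ lo u e + ppMidKernelS β Λ κ lo e u := by
  unfold ppFarKernelS ppMidKernelS
  rw [ppTrueKernel_symm β Λ u e, ppSmoothRatio_swap hlo e u]
  ring

/-- **`M` is symmetric**: `M(e,u) = M(u,e)`. [folklore] -/
theorem ppMidKernelS_symm {β Λ : ℝ} (κ : ℝ → ℝ) {lo : ℝ} (hlo : 0 < lo) (e u : ℝ) :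
    ppMidKernelS β Λ κ lo e u = ppMidKernelS β Λ κ lo u e := by
  unfold ppMidKernelS
  rw [ppTrueKernel_symm β Λ e u, ppSmoothRatio_swap hlo e u, sub_sub_cancel]
  ring

/-! ## §3 Supports -/

/-- **Far piece support, scale form**: `m̃(u) ≤ ((1−t₁)/t₁)·m̃(e) ⟹ r(e,u) ≥ t₁ ⟹ A(e,u) = 0` (`κ = 0` on `[t₁,∞)`, `0 < t₁`). [folklore] -/
theorem ppFarKernelS_eq_zero_of_scale_le {β Λ : ℝ} {κ : ℝ → ℝ} {t₁ lo e u : ℝ} (hlo : 0 < lo) (ht₀ : 0 < t₁) (hκs : ∀ t, t₁ ≤ t → κ t = 0)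
    (hu : ppSmoothScale lo u ≤ (1 - t₁) / t₁ * ppSmoothScale lo e) : ppFarKernelS β Λ κ lo e u = 0 := by
  have h1 := ppSmoothScale_pos hlo e
  have h2 := ppSmoothScale_pos hlo u
  unfold ppFarKernelS
  rw [hκs _ ?_, mul_zero]
  unfold ppSmoothRatio
  rw [le_div_iff₀ (by linarith)]
  have h3 : t₁ * ppSmoothScale lo u ≤ (1 - t₁) * ppSmoothScale lo e := by
    have := mul_le_mul_of_nonneg_left hu ht₀.le
    rwa [← mul_assoc, mul_div_cancel₀ _ ht₀.ne'] at this
  linarith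

/-- **Far piece support, the law's two-sided zone**: `|u| ≤ qs·|e|` with `1 ≤ qs ≤ (1−t₁)/t₁` ⟹ `A(e,u) = 0`. [folklore] -/
theorem ppFarKernelS_eq_zero_of_abs_le {β Λ : ℝ} {κ : ℝ → ℝ} {t₁ lo qs e u : ℝ} (hlo : 0 < lo) (ht₀ : 0 < t₁) (hκs : ∀ t, t₁ ≤ t → κ t = 0)
    (hqs1 : 1 ≤ qs) (hqs : qs ≤ (1 - t₁) / t₁) (hu : |u| ≤ qs * |e|) : ppFarKernelS β Λ κ lo e u = 0 :=
  ppFarKernelS_eq_zero_of_scale_le hlo ht₀ hκs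
    ((ppSmoothScale_le_mul hqs1 hu).trans (mul_le_mul_of_nonneg_right hqs (ppSmoothScale_pos hlo e).le))

/-- **`M` support, right form**: `((2−t₁)/t₁)·m̃(e) ≤ m̃(u)` ⟹ `κ(r) = 1`, `κ(1−r) = 0`, `M(e,u) = 0` (profile with `κ = 1` on `[0,t₁/2]`, `κ = 0` on `[t₁,∞)`,
`0 < t₁ ≤ 2/3`). [folklore] -/
theorem ppMidKernelS_eq_zero_of_scale_le_right {β Λ : ℝ} {κ : ℝ → ℝ} {t₁ lo e u : ℝ} (hlo : 0 < lo) (ht₀ : 0 < t₁) (ht : t₁ ≤ 2 / 3)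
    (hκs : ∀ t, t₁ ≤ t → κ t = 0) (hκ1 : ∀ t, t ≤ t₁ / 2 → κ t = 1) (hu : (2 - t₁) / t₁ * ppSmoothScale lo e ≤ ppSmoothScale lo u) :
    ppMidKernelS β Λ κ lo e u = 0 := by
  have h1 := ppSmoothScale_pos hlo e
  have h2 := ppSmoothScale_pos hlo u
  have h3 : (2 - t₁) * ppSmoothScale lo e ≤ t₁ * ppSmoothScale lo u := by
    have := mul_le_mul_of_nonneg_left hu ht₀.le
    rwa [← mul_assoc, mul_div_cancel₀ _ ht₀.ne'] at this
  have hr : ppSmoothRatio lo e u ≤ t₁ / 2 := by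
    unfold ppSmoothRatio; rw [div_le_iff₀ (by linarith)]; nlinarith
  have hr' : t₁ ≤ 1 - ppSmoothRatio lo e u := by linarith
  unfold ppMidKernelS
  rw [hκ1 _ hr, hκs _ hr']; ring

/-- **`M` support, left form** (by symmetry): `((2−t₁)/t₁)·m̃(u) ≤ m̃(e) ⟹ M(e,u) = 0`. [folklore] -/
theorem ppMidKernelS_eq_zero_of_scale_le_left {β Λ : ℝ} {κ : ℝ → ℝ} {t₁ lo e u : ℝ} (hlo : 0 < lo) (ht₀ : 0 < t₁) (ht : t₁ ≤ 2 / 3)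
    (hκs : ∀ t, t₁ ≤ t → κ t = 0) (hκ1 : ∀ t, t ≤ t₁ / 2 → κ t = 1) (he : (2 - t₁) / t₁ * ppSmoothScale lo u ≤ ppSmoothScale lo e) :
    ppMidKernelS β Λ κ lo e u = 0 := by
  rw [ppMidKernelS_symm κ hlo]
  exact ppMidKernelS_eq_zero_of_scale_le_right hlo ht₀ ht hκs hκ1 he

/-! ## §4 Envelopes -/

/-- `|A(e,u)| ≤ κ₀·|P(e,u)|`. [folklore] -/
theorem abs_ppFarKernelS_le {β Λ : ℝ} {κ : ℝ → ℝ} {κ₀ lo : ℝ} (hlo : 0 < lo) (hκb : ∀ t ∈ Icc (0 : ℝ) 1, |κ t| ≤ κ₀) (e u : ℝ) :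
    |ppFarKernelS β Λ κ lo e u| ≤ κ₀ * |ppTrueKernel β Λ e u| := by
  have hr := ppSmoothRatio_mem_Ioo hlo e u
  unfold ppFarKernelS
  rw [abs_mul, mul_comm]
  exact mul_le_mul_of_nonneg_right (hκb _ ⟨hr.1.le, hr.2.le⟩) (abs_nonneg _)

/-- `|M(e,u)| ≤ (1 + 2κ₀)·|P(e,u)|`. [folklore] -/
theorem abs_ppMidKernelS_le {β Λ : ℝ} {κ : ℝ → ℝ} {κ₀ lo : ℝ} (hlo : 0 < lo) (hκb : ∀ t ∈ Icc (0 : ℝ) 1, |κ t| ≤ κ₀) (e u : ℝ) :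
    |ppMidKernelS β Λ κ lo e u| ≤ (1 + 2 * κ₀) * |ppTrueKernel β Λ e u| := by
  have hr := ppSmoothRatio_mem_Ioo hlo e u
  have hk1 := hκb _ ⟨hr.1.le, hr.2.le⟩
  have hk2 := hκb (1 - ppSmoothRatio lo e u) ⟨by linarith [hr.2], by linarith [hr.1]⟩
  have h3 := abs_sub (1 : ℝ) (κ (ppSmoothRatio lo e u))
  rw [abs_one] at h3
  unfold ppMidKernelS
  rw [abs_mul, mul_comm]
  refine mul_le_mul_of_nonneg_right ?_ (abs_nonneg _)
  calc |1 - κ (ppSmoothRatio lo e u) - κ (1 - ppSmoothRatio lo e u)|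
      ≤ |1 - κ (ppSmoothRatio lo e u)| + |κ (1 - ppSmoothRatio lo e u)| := abs_sub _ _
    _ ≤ 1 + 2 * κ₀ := by linarith

/-- `|A(e,u)| ≤ κ₀(12B₁+9)·(max |e| |u|)⁻¹` (`e ≠ 0`) and `|M(e,u)| ≤ (1+2κ₀)(12B₁+9)·(max |e| |u|)⁻¹`. [cite: BenfattoGiulianiMastropietro2006, §2.4 (2.36)] -/
theorem abs_ppFarKernelS_le_inv_max {β Λ : ℝ} (hβ : 0 < β) (hΛ : 0 < Λ) {B₁ : ℝ} (hB₁ : ∀ x, |deriv salmhoferCutoff x| ≤ B₁) {κ : ℝ → ℝ} {κ₀ lo : ℝ}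
    (hlo : 0 < lo) (hκb : ∀ t ∈ Icc (0 : ℝ) 1, |κ t| ≤ κ₀) {e : ℝ} (he : e ≠ 0) (u : ℝ) :
    |ppFarKernelS β Λ κ lo e u| ≤ κ₀ * (12 * B₁ + 9) * (max |e| |u|)⁻¹ ∧
      |ppMidKernelS β Λ κ lo e u| ≤ (1 + 2 * κ₀) * (12 * B₁ + 9) * (max |e| |u|)⁻¹ := by
  have hκ₀ : 0 ≤ κ₀ := (abs_nonneg _).trans (hκb 0 (left_mem_Icc.2 zero_le_one))
  have hP := abs_ppTrueKernel_le_inv_max_abs hβ hΛ hB₁ he u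
  constructor
  · rw [mul_assoc]; exact (abs_ppFarKernelS_le hlo hκb e u).trans (mul_le_mul_of_nonneg_left hP hκ₀)
  · rw [mul_assoc]; exact (abs_ppMidKernelS_le hlo hκb e u).trans (mul_le_mul_of_nonneg_left hP (by positivity))

end Summit.HubbardSuperconductivity.HubbardSuperconductivity.Theorems.C4a

end
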